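/-
Copyright (c) 2026 the pub-hodgecm-mathlib formalisation cell (harness21).  Prover seat hodgecm-mathlib-K2E5-p10 (g4), Track B «K2-LIT» ∕ h413
(`stmt-HodgeConjecture-24833`), line `K2_E3_EllipticInputs`, unit U12, §L leaf (LBGL-2b) brick (b-ii)/(LC): THE LOWER-CELL SLICE INTEGRAL OF `𝔤𝔩₂(F)` —
`∫_F ∫_𝔟 g(n⁻(s) B n⁻(s)⁻¹) dB ds = 2 ∫ 1[disc χ_X ∈ (Fˣ)²] ‖disc χ_X‖^{-1∕2} g(X) dX` (the Weyl Jacobian of the Borel slice, via the 1-D squaring push-forward).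
2026-09-04.
-/
import Summits.HodgeConjecture.HodgeConjecture.Theorems.K2E3LocalFieldSquarePushforward        -- ★ (this seat): `lintegral_comp_sq_eq` (the squaring push-forward)
import Summits.HodgeConjecture.HodgeConjecture.Theorems.K2E3GL2RegularNilpotentFourierLineInversion  -- ★ p856988 (K2E5-p17 (g3)): the chart `x ↦ [[x₁,x₂],[x₀,x₃]]`, `isAddHaarMeasure_map_chart`
import HarnessLib

/-!
# K2_E3 road (h413), §L brick (LC) — the lower-cell slice integral of `𝔤𝔩₂(F)` and its Weyl Jacobian

Cell `pub/hodgecm-mathlib` (D-0151), Track B, seat K2E5-p10 (g4) (free E5 hand on the E3 §L line; §L lead K2E3-p12 (g4), dealer K2E3-plan (g2)).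
`--supports stmt-HodgeConjecture-24833 --as helper`; THEOREMS ONLY (no definition ∕ instance ∕ notation ∕ named fact ∕ `sorry`); never imports
`Cruxes/…/Lines`.  COUNT-NEUTRAL.

The leaf (LBGL-2b) of U12 is, after ★ p856988 (b-i) and ★ p857004 (the assembly over a Borel-slice density), the statement that the push-forward of
`dk ⊗ dB` under `K × 𝔟 → 𝔤𝔩₂(F)`, `(k, B) ↦ k B k⁻¹`, has density `c·1[disc χ_X ∈ (Fˣ)²]·‖disc χ_X‖^{-1∕2}` — the Lie–Weyl formula for the split Cartan,
organised along the Bruhat cells of `K = GL₂(𝒪)`.  This file computes the contribution of the big cell in the coordinate `s` of `n⁻(s) = [[1,0],[s,1]]`: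
for every measurable `g ≥ 0` on `𝔤𝔩₂(F)`,
  `∫⁻ s, ∫⁻ r, g [[r₀ − s r₁, r₁],[s(r₀ − r₂) − s² r₁, r₂ + s r₁]] d(dx^{⊗3})(r) ddx(s) = 2 ∫⁻ y, 1[disc ∈ (Fˣ)²] (√‖disc‖)⁻¹ g [[y₁,y₂],[y₀,y₃]] d(dx^{⊗4})(y)`
(`n⁻(s) [[r₀,r₁],[0,r₂]] n⁻(s)⁻¹ = [[r₀ − s r₁, r₁],[s(r₀ − r₂) − s² r₁, r₂ + s r₁]]`).  Steps:
* §1 the shear `r ↦ (r₀ − s r₁, r₁, r₂ + s r₁)` preserves `dx^{⊗3}` (a skew product of translations over the coordinate `r₁`), so the inner integral is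
  `∫⁻ x, g [[x₀, x₁],[x₁ s² + (x₀ − x₂) s, x₂]] dx` — for fixed `(x₀,x₁,x₂)` the lower-left entry is the QUADRATIC `q(s) = x₁ s² + (x₀ − x₂) s`;
* §2 for `x₁ ≠ 0`: `∫⁻ s, h(q(s)) ds = 2 ∫⁻ x₃, 1[D ∈ (Fˣ)²] (√‖D‖)⁻¹ h(x₃) dx₃` with `D = (x₀ − x₂)² + 4 x₁ x₃` — complete the square, ★ `lintegral_comp_sq_eq`, and the
  affine substitution `x₃ = x₁ y − (x₀−x₂)²∕(4x₁)` (`y = D∕(2x₁)²` is a non-zero square iff `D` is; `‖2x₁‖∕√‖D‖ · ‖x₁‖⁻¹ · 2∕‖2‖ = 2∕√‖D‖`);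
* §3 Tonelli (`s` innermost), the null hyperplane `{x₁ = 0}`, re-assembly of `F³ × F` into `F⁴` (`piFinSuccAbove` at `0`), and
  `disc χ_{[[y₁,y₂],[y₀,y₃]]} = (y₁ − y₃)² + 4 y₂ y₀` (Mathlib `Matrix.discr_fin_two`): **`lintegral_lowerCell_slice_eq`**; the `μ𝔤`-form with the Haar
  ratio `μ𝔤 ∕ chart_* dx^{⊗4}` is `lintegral_lowerCell_slice_eq_haar`.
[HarishChandra1999AdmissibleDistributions, §7 (rank one), Thm. 4.4] [Weil1965, Chap. I n° 2–6] [Igusa1978, Ch. II §7]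
HONEST LABEL: HC_CM is proved only modulo the 7 printed citations (2 remaining named inputs: hLiu418 = stmt-HodgeConjecture-24832, h413 =
stmt-HodgeConjecture-24833) until rung 0 closes; count-neutral helper toward (LBGL-2b); (L-B_GL) :478 of U12 stays OPEN.

## References
* [HarishChandra1999AdmissibleDistributions] Harish-Chandra (DeBacker–Sally), *Admissible Invariant Distributions on Reductive p-adic Groups* (1999), Thm. 4.4, §7.
* [Weil1965] A. Weil, *Sur la formule de Siegel dans la théorie des groupes classiques*, Acta Math. 113 (1965), Chap. I n° 2–6.
* [Igusa1978] J.-I. Igusa, *Lectures on Forms of Higher Degree* (1978), Ch. II §7.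
-/

set_option autoImplicit false
set_option linter.dupNamespace false   -- `Summit.HodgeConjecture.HodgeConjecture.…` (D-0017 nested layout; lakefile exemption for Summits)

noncomputable section

open MeasureTheory Measure Filter Topology Set
open scoped NNReal ENNReal Pointwise
open ValuativeRel
open Literature.NumberTheory.Automorphic Literature.NumberTheory.Automorphic.LocalFieldHaar
open Literature.NumberTheory.GaloisRepresentations Literature.NumberTheory.GaloisRepresentations.IsNonarchimedeanLocalField
open Summit.HodgeConjecture.HodgeConjecture.Cruxes.H413.K2E3LocalFieldSquaresHensel
open Summit.HodgeConjecture.HodgeConjecture.Cruxes.H413.K2E3LocalFieldSquarePushforward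
open Summit.HodgeConjecture.HodgeConjecture.Cruxes.H413.K2E3GL2RegularNilpotentFourierLineInversion

namespace Summit.HodgeConjecture.HodgeConjecture.Cruxes.H413.K2E3GL2BorelSliceLowerCell

variable {F : Type*} [Field F] [ValuativeRel F] [TopologicalSpace F] [IsNonarchimedeanLocalField F]

/-! ## §1  The shear `r ↦ (r₀ − s r₁, r₁, r₂ + s r₁)` preserves `dx^{⊗3}` -/

omit [ValuativeRel F] [TopologicalSpace F] [IsNonarchimedeanLocalField F] in
/-- The conjugate `n⁻(s) [[r₀,r₁],[0,r₂]] n⁻(s)⁻¹` in the sheared coordinates `x = (r₀ − s r₁, r₁, r₂ + s r₁)`: its entries are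
`[[x₀, x₁],[x₁ s² + (x₀ − x₂) s, x₂]]`. [cite: HarishChandra1999AdmissibleDistributions, §7] -/
theorem lowerCell_matrix_eq (s : F) (r : Fin 3 → F) :
    (!![r 0 - s * r 1, r 1; s * (r 0 - r 2) - s ^ 2 * r 1, r 2 + s * r 1] : Matrix (Fin 2) (Fin 2) F) =
      !![(r 0 - s * r 1), r 1; r 1 * s ^ 2 + ((r 0 - s * r 1) - (r 2 + s * r 1)) * s, r 2 + s * r 1] := by
  ext i j
  fin_cases i <;> fin_cases j
  · rfl
  · rfl
  · simp only [Matrix.of_apply, Matrix.cons_val', Matrix.cons_val_fin_one]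
    ring
  · rfl

omit [ValuativeRel F] [TopologicalSpace F] [IsNonarchimedeanLocalField F] in
/-- `D ∕ (2a)²` is a non-zero square iff `D` is. [folklore] -/
theorem isSquare_and_ne_zero_div_sq_iff {c : F} (hc : c ≠ 0) (D : F) :
    (IsSquare (D * (c ^ 2)⁻¹) ∧ D * (c ^ 2)⁻¹ ≠ 0) ↔ (IsSquare D ∧ D ≠ 0) := by
  have hc2 : c ^ 2 ≠ 0 := pow_ne_zero 2 hc
  constructor
  · rintro ⟨⟨r, hr⟩, h0⟩
    refine ⟨⟨r * c, ?_⟩, fun hD => h0 (by rw [hD, zero_mul])⟩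
    have : D = D * (c ^ 2)⁻¹ * c ^ 2 := by rw [mul_assoc, inv_mul_cancel₀ hc2, mul_one]
    rw [this, hr]; ring
  · rintro ⟨⟨r, hr⟩, h0⟩
    refine ⟨⟨r * c⁻¹, ?_⟩, mul_ne_zero h0 (inv_ne_zero hc2)⟩
    rw [hr]; field_simp

section Pi

variable [MeasurableSpace F] [BorelSpace F] (dx : Measure F) [dx.IsAddHaarMeasure]
  [MeasurableSpace (Matrix (Fin 2) (Fin 2) F)] [BorelSpace (Matrix (Fin 2) (Fin 2) F)]

omit [MeasurableSpace (Matrix (Fin 2) (Fin 2) F)] [BorelSpace (Matrix (Fin 2) (Fin 2) F)] in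
/-- **The shear `r ↦ (r₀ − s r₁, r₁, r₂ + s r₁)` preserves `dx^{⊗3}`** (over the coordinate `r₁` it is a family of translations of `F²`). [folklore] -/
theorem measurePreserving_shear (s : F) :
    MeasurePreserving (fun r : Fin 3 → F => (![r 0 - s * r 1, r 1, r 2 + s * r 1] : Fin 3 → F))
      (Measure.pi fun _ : Fin 3 => dx) (Measure.pi fun _ : Fin 3 => dx) := by
  haveI : T2Space F := (isLocalField F).toT2Space
  haveI : SecondCountableTopology F := secondCountableTopology_localField F
  -- split off the coordinate `1`: `F³ ≃ F × F²`
  let e1 : (Fin 3 → F) ≃ᵐ F × (Fin 2 → F) := MeasurableEquiv.piFinSuccAbove (fun _ : Fin 3 => F) 1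
  have he1 : MeasurePreserving e1 (Measure.pi fun _ : Fin 3 => dx) (dx.prod (Measure.pi fun _ : Fin 2 => dx)) :=
    measurePreserving_piFinSuccAbove (fun _ : Fin 3 => dx) 1
  -- the skew product `(c, y) ↦ (c, y + (−s c, s c))`
  let T : F × (Fin 2 → F) → F × (Fin 2 → F) := fun p => (p.1, p.2 + ![-(s * p.1), s * p.1])
  have hT : MeasurePreserving T (dx.prod (Measure.pi fun _ : Fin 2 => dx)) (dx.prod (Measure.pi fun _ : Fin 2 => dx)) := by
    refine (MeasurePreserving.id dx).skew_product (g := fun c y => y + ![-(s * c), s * c]) ?_ ?_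
    · refine measurable_snd.add ?_
      refine measurable_pi_iff.2 fun i => ?_
      fin_cases i
      · exact (measurable_fst.const_mul s).neg
      · exact measurable_fst.const_mul s
    · exact Filter.Eventually.of_forall fun c => map_add_right_eq_self _ _
  have hcomp : (fun r : Fin 3 → F => (![r 0 - s * r 1, r 1, r 2 + s * r 1] : Fin 3 → F)) = e1.symm ∘ T ∘ e1 := by
    funext r
    simp only [Function.comp_apply]
    rw [← e1.symm_apply_apply (![r 0 - s * r 1, r 1, r 2 + s * r 1] : Fin 3 → F)]
    congr 1
    have h10 : (1 : Fin 3).succAbove 0 = 0 := rfl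
    have h11 : (1 : Fin 3).succAbove 1 = 2 := rfl
    refine Prod.ext ?_ ?_
    · simp [e1, T]
    · funext j
      simp only [e1, T, MeasurableEquiv.piFinSuccAbove_apply, Pi.add_apply]
      fin_cases j
      · show (![r 0 - s * r 1, r 1, r 2 + s * r 1] : Fin 3 → F) ((1 : Fin 3).succAbove 0) =
          r ((1 : Fin 3).succAbove 0) + (![-(s * r 1), s * r 1] : Fin 2 → F) 0
        rw [h10]
        simp [sub_eq_add_neg]
      · show (![r 0 - s * r 1, r 1, r 2 + s * r 1] : Fin 3 → F) ((1 : Fin 3).succAbove 1) =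
          r ((1 : Fin 3).succAbove 1) + (![-(s * r 1), s * r 1] : Fin 2 → F) 1
        rw [h11]
        simp
  rw [hcomp]
  exact (he1.symm e1).comp (hT.comp he1)

/-- **Step A**: `∫⁻ r, g(n⁻(s)·[[r₀,r₁],[0,r₂]]·n⁻(s)⁻¹) dr = ∫⁻ x, g [[x₀, x₁],[x₁ s² + (x₀ − x₂) s, x₂]] dx` (shear). [folklore] -/
theorem lintegral_lowerCell_shear (s : F) (g : Matrix (Fin 2) (Fin 2) F → ℝ≥0∞) (hg : Measurable g) :
    ∫⁻ r : Fin 3 → F, g !![r 0 - s * r 1, r 1; s * (r 0 - r 2) - s ^ 2 * r 1, r 2 + s * r 1] ∂(Measure.pi fun _ : Fin 3 => dx) =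
      ∫⁻ x : Fin 3 → F, g !![x 0, x 1; x 1 * s ^ 2 + (x 0 - x 2) * s, x 2] ∂(Measure.pi fun _ : Fin 3 => dx) := by
  haveI : T2Space F := (isLocalField F).toT2Space
  haveI : SecondCountableTopology F := secondCountableTopology_localField F
  have hN : Measurable fun x : Fin 3 → F => (!![x 0, x 1; x 1 * s ^ 2 + (x 0 - x 2) * s, x 2] : Matrix (Fin 2) (Fin 2) F) := by
    refine (continuous_matrix fun i j => ?_).measurable
    fin_cases i <;> fin_cases j <;> simp <;> fun_prop
  have h := (measurePreserving_shear dx s).lintegral_comp (hg.comp hN)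
  refine Eq.trans (lintegral_congr fun r => ?_) h
  rw [Function.comp_apply, lowerCell_matrix_eq]
  congr 1

/-! ## §2  The quadratic substitution `∫⁻ h(a s² + β s) ds = 2 ∫⁻ 1[D ∈ (Fˣ)²] (√‖D‖)⁻¹ h(x) dx`, `D = β² + 4 a x` -/

omit [MeasurableSpace (Matrix (Fin 2) (Fin 2) F)] [BorelSpace (Matrix (Fin 2) (Fin 2) F)] in
/-- **The quadratic substitution** (`a ≠ 0`, characteristic `≠ 2`): for every measurable `h ≥ 0`,
`∫⁻ s, h (a s² + β s) ds = 2 ∫⁻ x, 1[β² + 4ax ∈ (Fˣ)²] (√‖β² + 4ax‖)⁻¹ h(x) dx` — complete the square, the squaring push-forward ★ `lintegral_comp_sq_eq`, and the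
affine substitution `x = a y − β²∕(4a)` (`y = (β² + 4ax)∕(2a)²`, `dy = ‖a‖⁻¹ dx`, `(√‖y‖)⁻¹ = ‖2a‖ (√‖β² + 4ax‖)⁻¹`).  The fibre of `s ↦ a s² + β s` over `x` has two points
iff the discriminant `β² + 4ax` is a non-zero square, and the Jacobian there is `‖2as + β‖ = √‖β² + 4ax‖`. [cite: Igusa1978, Ch. II §7] [cite: Weil1965, Chap. I n° 2–6] -/
theorem lintegral_comp_quadratic_eq (h2 : (2 : F) ≠ 0) {a : F} (ha : a ≠ 0) (β : F) (h : F → ℝ≥0∞) (hh : Measurable h) :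
    ∫⁻ s, h (a * s ^ 2 + β * s) ∂dx =
      2 * ∫⁻ x, {D : F | IsSquare D ∧ D ≠ 0}.indicator (fun D => (((NNReal.sqrt (normAbs F D))⁻¹ : ℝ≥0) : ℝ≥0∞)) (β ^ 2 + 4 * a * x) * h x ∂dx := by
  haveI : T2Space F := (isLocalField F).toT2Space
  have h4 : (4 : F) ≠ 0 := by rw [show (4 : F) = 2 * 2 by norm_num]; exact mul_ne_zero h2 h2
  have h4a : 4 * a ≠ 0 := mul_ne_zero h4 ha
  have h2a : 2 * a ≠ 0 := mul_ne_zero h2 ha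
  set γ : F := β ^ 2 / (4 * a) with hγ
  set S : Set F := {D : F | IsSquare D ∧ D ≠ 0} with hS
  have hSm : MeasurableSet S := (isOpen_setOf_isSquare_and_ne_zero h2).measurableSet
  have hsqm : Measurable fun x : F => (((NNReal.sqrt (normAbs F x))⁻¹ : ℝ≥0) : ℝ≥0∞) :=
    (NNReal.continuous_sqrt.measurable.comp measurable_normAbs).inv.coe_nnreal_ennreal
  -- C1: complete the square
  have hC1 : ∫⁻ s, h (a * s ^ 2 + β * s) ∂dx = ∫⁻ s, h (a * s ^ 2 - γ) ∂dx := by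
    rw [← lintegral_add_right_eq_self (μ := dx) (fun s => h (a * s ^ 2 - γ)) (β / (2 * a))]
    refine lintegral_congr fun s => ?_
    congr 1
    rw [hγ]
    field_simp
    ring
  -- C2: the squaring push-forward
  have hg₁ : Measurable fun y : F => h (a * y - γ) := hh.comp ((measurable_const_mul a).sub_const γ)
  have hC2 := lintegral_comp_sq_eq dx h2 (fun y => h (a * y - γ)) hg₁
  -- C3: the affine substitution `y = a⁻¹ (x + γ)`
  set Φ : F → ℝ≥0∞ := S.indicator fun y => (((NNReal.sqrt (normAbs F y))⁻¹ : ℝ≥0) : ℝ≥0∞) * h (a * y - γ) with hΦ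
  have hΦm : Measurable Φ := (hsqm.mul hg₁).indicator hSm
  have hC3 : ∫⁻ y, Φ y ∂dx = ((normAbs F a)⁻¹ : ℝ≥0) * ∫⁻ x, Φ (a⁻¹ * (x + γ)) ∂dx := by
    have h1 : ∫⁻ x, Φ (a⁻¹ * (x + γ)) ∂dx = ∫⁻ x, Φ (a⁻¹ * x) ∂dx :=
      lintegral_add_right_eq_self (μ := dx) (fun x => Φ (a⁻¹ * x)) γ
    rw [h1, lintegral_comp_mul_left dx Φ (inv_ne_zero ha), map_inv₀, inv_inv, ← mul_assoc, ← ENNReal.coe_mul,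
      inv_mul_cancel₀ ((map_ne_zero (normAbs F)).2 ha), ENNReal.coe_one, one_mul]
  -- C4: the substituted integrand
  have hC4 : ∀ x : F, Φ (a⁻¹ * (x + γ)) = (normAbs F (2 * a) : ℝ≥0∞) * (S.indicator (fun D => (((NNReal.sqrt (normAbs F D))⁻¹ : ℝ≥0) : ℝ≥0∞))
      (β ^ 2 + 4 * a * x) * h x) := by
    intro x
    have hy : a⁻¹ * (x + γ) = (β ^ 2 + 4 * a * x) * ((2 * a) ^ 2)⁻¹ := by
      rw [hγ]; field_simp; ring
    have hback : a * (a⁻¹ * (x + γ)) - γ = x := by rw [← mul_assoc, mul_inv_cancel₀ ha, one_mul, add_sub_cancel_right]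
    rw [hΦ]
    by_cases hD : IsSquare (β ^ 2 + 4 * a * x) ∧ β ^ 2 + 4 * a * x ≠ 0
    · have hyS : a⁻¹ * (x + γ) ∈ S := by rw [hy]; exact (isSquare_and_ne_zero_div_sq_iff h2a _).2 hD
      rw [indicator_of_mem hyS, indicator_of_mem (show β ^ 2 + 4 * a * x ∈ S from hD), hback, ← mul_assoc]
      congr 1
      rw [hy, map_mul, map_inv₀, map_pow, NNReal.sqrt_mul, NNReal.sqrt_inv, NNReal.sqrt_sq, mul_inv, inv_inv, ENNReal.coe_mul, mul_comm]
    · have hyS : a⁻¹ * (x + γ) ∉ S := by rw [hy]; exact fun hm => hD ((isSquare_and_ne_zero_div_sq_iff h2a _).1 hm)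
      rw [indicator_of_notMem hyS, indicator_of_notMem (show β ^ 2 + 4 * a * x ∉ S from hD), zero_mul, mul_zero]
  -- assembly
  have hC2' : ∫⁻ s, h (a * s ^ 2 - γ) ∂dx = (((2 : ℝ≥0) / normAbs F 2 : ℝ≥0) : ℝ≥0∞) * ∫⁻ y, Φ y ∂dx := by
    rw [hC2, ← lintegral_indicator hSm]
  have hDm : Measurable fun x : F => β ^ 2 + 4 * a * x := (measurable_const_mul (4 * a)).const_add (β ^ 2)
  have hwm : Measurable fun x : F => S.indicator (fun D => (((NNReal.sqrt (normAbs F D))⁻¹ : ℝ≥0) : ℝ≥0∞)) (β ^ 2 + 4 * a * x) * h x :=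
    ((hsqm.indicator hSm).comp hDm).mul hh
  have hconst : (((2 : ℝ≥0) / normAbs F 2 : ℝ≥0) : ℝ≥0∞) * ((((normAbs F a)⁻¹ : ℝ≥0) : ℝ≥0∞) * (normAbs F (2 * a) : ℝ≥0∞)) = 2 := by
    rw [← ENNReal.coe_mul, ← ENNReal.coe_mul, map_mul]
    have h20 : normAbs F 2 ≠ 0 := (map_ne_zero (normAbs F)).2 h2
    have ha0 : normAbs F a ≠ 0 := (map_ne_zero (normAbs F)).2 ha
    have : (2 : ℝ≥0) / normAbs F 2 * ((normAbs F a)⁻¹ * (normAbs F 2 * normAbs F a)) = 2 := by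
      field_simp
    rw [this, ENNReal.coe_ofNat]
  calc ∫⁻ s, h (a * s ^ 2 + β * s) ∂dx = ∫⁻ s, h (a * s ^ 2 - γ) ∂dx := hC1
    _ = (((2 : ℝ≥0) / normAbs F 2 : ℝ≥0) : ℝ≥0∞) * ∫⁻ y, Φ y ∂dx := hC2'
    _ = (((2 : ℝ≥0) / normAbs F 2 : ℝ≥0) : ℝ≥0∞) * ((((normAbs F a)⁻¹ : ℝ≥0) : ℝ≥0∞) *
          ∫⁻ x, (normAbs F (2 * a) : ℝ≥0∞) * (S.indicator (fun D => (((NNReal.sqrt (normAbs F D))⁻¹ : ℝ≥0) : ℝ≥0∞)) (β ^ 2 + 4 * a * x) * h x) ∂dx) := by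
        rw [hC3]
        congr 2
        exact lintegral_congr fun x => hC4 x
    _ = 2 * ∫⁻ x, S.indicator (fun D => (((NNReal.sqrt (normAbs F D))⁻¹ : ℝ≥0) : ℝ≥0∞)) (β ^ 2 + 4 * a * x) * h x ∂dx := by
        rw [lintegral_const_mul _ hwm, ← mul_assoc, ← mul_assoc, mul_assoc (((2 : ℝ≥0) / normAbs F 2 : ℝ≥0) : ℝ≥0∞), hconst]

/-! ## §3  The lower-cell slice integral -/

omit [ValuativeRel F] [TopologicalSpace F] [IsNonarchimedeanLocalField F] [MeasurableSpace F] [BorelSpace F]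
  [MeasurableSpace (Matrix (Fin 2) (Fin 2) F)] [BorelSpace (Matrix (Fin 2) (Fin 2) F)] in
/-- `disc χ_{[[x₀,x₁],[t,x₂]]} = (x₀ − x₂)² + 4 x₁ t` (Mathlib `Matrix.discr_fin_two`). [cite: HarishChandra1999AdmissibleDistributions, §7] -/
theorem discr_charpoly_fin_two_explicit (x₀ x₁ t x₂ : F) :
    ((!![x₀, x₁; t, x₂] : Matrix (Fin 2) (Fin 2) F)).charpoly.discr = (x₀ - x₂) ^ 2 + 4 * x₁ * t := by
  have h : ((!![x₀, x₁; t, x₂] : Matrix (Fin 2) (Fin 2) F)).charpoly.discr =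
      ((!![x₀, x₁; t, x₂] : Matrix (Fin 2) (Fin 2) F)).trace ^ 2 - 4 * ((!![x₀, x₁; t, x₂] : Matrix (Fin 2) (Fin 2) F)).det :=
    Matrix.discr_fin_two _
  rw [h, Matrix.trace_fin_two, Matrix.det_fin_two]
  simp only [Matrix.of_apply, Matrix.cons_val', Matrix.cons_val_zero, Matrix.cons_val_one, Matrix.cons_val_fin_one]
  ring

omit [MeasurableSpace (Matrix (Fin 2) (Fin 2) F)] [BorelSpace (Matrix (Fin 2) (Fin 2) F)] in
/-- The hyperplane `{x₁ = 0}` of `F³` is `dx^{⊗3}`-null. [folklore] -/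
theorem pi_setOf_apply_one_eq_zero : (Measure.pi fun _ : Fin 3 => dx) {x : Fin 3 → F | x 1 = 0} = 0 := by
  haveI : T2Space F := (isLocalField F).toT2Space
  haveI : LocallyCompactSpace F := (isLocalField F).toLocallyCompactSpace
  haveI : SecondCountableTopology F := secondCountableTopology_localField F
  have h : {x : Fin 3 → F | x 1 = 0} = Set.pi univ (fun i : Fin 3 => if i = 1 then ({0} : Set F) else univ) := by
    ext x
    simp only [mem_setOf_eq, mem_univ_pi]
    constructor
    · intro hx i
      by_cases hi : i = 1
      · subst hi; simpa using hx
      · simp [hi]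
    · intro hx; simpa using hx 1
  rw [h, Measure.pi_pi]
  apply Finset.prod_eq_zero (Finset.mem_univ (1 : Fin 3))
  simp [measure_singleton_zero dx]

/-- **THE LOWER-CELL SLICE INTEGRAL.**  For every measurable `g ≥ 0` on `𝔤𝔩₂(F)` (`F` of characteristic `≠ 2`),
`∫⁻ s, ∫⁻ r, g (n⁻(s) [[r₀,r₁],[0,r₂]] n⁻(s)⁻¹) d(dx^{⊗3}) ddx = 2 ∫⁻ y, 1[disc ∈ (Fˣ)²] (√‖disc‖)⁻¹ g [[y₁,y₂],[y₀,y₃]] d(dx^{⊗4})`,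
`n⁻(s) [[r₀,r₁],[0,r₂]] n⁻(s)⁻¹ = [[r₀ − s r₁, r₁],[s(r₀ − r₂) − s² r₁, r₂ + s r₁]]`, `disc = disc χ` of the matrix on the right: the Weyl Jacobian of the Borel slice
of `𝔤𝔩₂` over the big Bruhat cell (shear §1, Tonelli, the quadratic substitution §2 fibrewise off the null hyperplane `{x₁ = 0}`, and `F × F³ ≅ F⁴`).
[cite: HarishChandra1999AdmissibleDistributions, Thm. 4.4, §7] [cite: Igusa1978, Ch. II §7] -/
theorem lintegral_lowerCell_slice_eq (h2 : (2 : F) ≠ 0) (g : Matrix (Fin 2) (Fin 2) F → ℝ≥0∞) (hg : Measurable g) :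
    ∫⁻ s, ∫⁻ r : Fin 3 → F, g !![r 0 - s * r 1, r 1; s * (r 0 - r 2) - s ^ 2 * r 1, r 2 + s * r 1] ∂(Measure.pi fun _ : Fin 3 => dx) ∂dx =
      2 * ∫⁻ y : Fin 4 → F, {D : F | IsSquare D ∧ D ≠ 0}.indicator (fun D => (((NNReal.sqrt (normAbs F D))⁻¹ : ℝ≥0) : ℝ≥0∞))
        ((!![y 1, y 2; y 0, y 3] : Matrix (Fin 2) (Fin 2) F)).charpoly.discr * g !![y 1, y 2; y 0, y 3] ∂(Measure.pi fun _ : Fin 4 => dx) := by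
  haveI : T2Space F := (isLocalField F).toT2Space
  haveI : LocallyCompactSpace F := (isLocalField F).toLocallyCompactSpace
  haveI : SecondCountableTopology F := secondCountableTopology_localField F
  set S : Set F := {D : F | IsSquare D ∧ D ≠ 0} with hS
  have hSm : MeasurableSet S := (isOpen_setOf_isSquare_and_ne_zero h2).measurableSet
  have hsqm : Measurable fun x : F => (((NNReal.sqrt (normAbs F x))⁻¹ : ℝ≥0) : ℝ≥0∞) :=
    (NNReal.continuous_sqrt.measurable.comp measurable_normAbs).inv.coe_nnreal_ennreal
  have hwm : Measurable (S.indicator fun D => (((NNReal.sqrt (normAbs F D))⁻¹ : ℝ≥0) : ℝ≥0∞)) := hsqm.indicator hSm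
  -- the matrices `M(x, t) = [[x₀, x₁],[t, x₂]]` and `N(s, x) = M(x, x₁ s² + (x₀ − x₂) s)` depend continuously on their arguments
  have hM : Continuous fun p : F × (Fin 3 → F) => (!![p.2 0, p.2 1; p.1, p.2 2] : Matrix (Fin 2) (Fin 2) F) := by
    refine continuous_matrix fun i j => ?_
    fin_cases i <;> fin_cases j <;> simp <;> fun_prop
  have hN : Continuous fun p : F × (Fin 3 → F) => (!![p.2 0, p.2 1; p.2 1 * p.1 ^ 2 + (p.2 0 - p.2 2) * p.1, p.2 2] : Matrix (Fin 2) (Fin 2) F) := by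
    refine continuous_matrix fun i j => ?_
    fin_cases i <;> fin_cases j <;> simp <;> fun_prop
  -- STEP A (shear), under the `s`-integral
  have hA : ∫⁻ s, ∫⁻ r : Fin 3 → F, g !![r 0 - s * r 1, r 1; s * (r 0 - r 2) - s ^ 2 * r 1, r 2 + s * r 1] ∂(Measure.pi fun _ : Fin 3 => dx) ∂dx =
      ∫⁻ s, ∫⁻ x : Fin 3 → F, g !![x 0, x 1; x 1 * s ^ 2 + (x 0 - x 2) * s, x 2] ∂(Measure.pi fun _ : Fin 3 => dx) ∂dx :=
    lintegral_congr fun s => lintegral_lowerCell_shear dx s g hg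
  -- STEP B (Tonelli: `s` innermost)
  have hB : ∫⁻ s, ∫⁻ x : Fin 3 → F, g !![x 0, x 1; x 1 * s ^ 2 + (x 0 - x 2) * s, x 2] ∂(Measure.pi fun _ : Fin 3 => dx) ∂dx =
      ∫⁻ x : Fin 3 → F, ∫⁻ s, g !![x 0, x 1; x 1 * s ^ 2 + (x 0 - x 2) * s, x 2] ∂dx ∂(Measure.pi fun _ : Fin 3 => dx) :=
    lintegral_lintegral_swap ((hg.comp hN.measurable).aemeasurable)
  -- STEP C (the quadratic substitution, off `{x₁ = 0}`)
  have hC : ∀ x : Fin 3 → F, x 1 ≠ 0 →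
      ∫⁻ s, g !![x 0, x 1; x 1 * s ^ 2 + (x 0 - x 2) * s, x 2] ∂dx =
        2 * ∫⁻ t, S.indicator (fun D => (((NNReal.sqrt (normAbs F D))⁻¹ : ℝ≥0) : ℝ≥0∞)) ((x 0 - x 2) ^ 2 + 4 * x 1 * t) *
          g !![x 0, x 1; t, x 2] ∂dx := by
    intro x hx
    exact lintegral_comp_quadratic_eq dx h2 hx (x 0 - x 2) (fun t => g !![x 0, x 1; t, x 2])
      (hg.comp (hM.measurable.comp (measurable_id.prodMk measurable_const)))
  have hC' : (fun x : Fin 3 → F => ∫⁻ s, g !![x 0, x 1; x 1 * s ^ 2 + (x 0 - x 2) * s, x 2] ∂dx) =ᵐ[Measure.pi fun _ : Fin 3 => dx]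
      fun x => 2 * ∫⁻ t, S.indicator (fun D => (((NNReal.sqrt (normAbs F D))⁻¹ : ℝ≥0) : ℝ≥0∞)) ((x 0 - x 2) ^ 2 + 4 * x 1 * t) *
        g !![x 0, x 1; t, x 2] ∂dx := by
    have hae : ∀ᵐ x ∂(Measure.pi fun _ : Fin 3 => dx), x ∈ ({x : Fin 3 → F | x 1 = 0}ᶜ : Set (Fin 3 → F)) :=
      compl_mem_ae_iff.2 (pi_setOf_apply_one_eq_zero dx)
    filter_upwards [hae] with x hx
    exact hC x hx
  -- STEP D (`F × F³ ≅ F⁴`): the right-hand side as an iterated integral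
  set G : F × (Fin 3 → F) → ℝ≥0∞ := fun p =>
    S.indicator (fun D => (((NNReal.sqrt (normAbs F D))⁻¹ : ℝ≥0) : ℝ≥0∞)) ((p.2 0 - p.2 2) ^ 2 + 4 * p.2 1 * p.1) * g !![p.2 0, p.2 1; p.1, p.2 2]
    with hGdef
  have hG : Measurable G := by
    refine (hwm.comp ?_).mul (hg.comp hM.measurable)
    exact Continuous.measurable (by fun_prop)
  let e0 : (Fin 4 → F) ≃ᵐ F × (Fin 3 → F) := MeasurableEquiv.piFinSuccAbove (fun _ : Fin 4 => F) 0
  have he0 : MeasurePreserving e0 (Measure.pi fun _ : Fin 4 => dx) (dx.prod (Measure.pi fun _ : Fin 3 => dx)) :=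
    measurePreserving_piFinSuccAbove (fun _ : Fin 4 => dx) 0
  have hD : ∫⁻ y : Fin 4 → F, S.indicator (fun D => (((NNReal.sqrt (normAbs F D))⁻¹ : ℝ≥0) : ℝ≥0∞))
        ((!![y 1, y 2; y 0, y 3] : Matrix (Fin 2) (Fin 2) F)).charpoly.discr * g !![y 1, y 2; y 0, y 3] ∂(Measure.pi fun _ : Fin 4 => dx) =
      ∫⁻ x : Fin 3 → F, ∫⁻ t, G (t, x) ∂dx ∂(Measure.pi fun _ : Fin 3 => dx) := by
    calc ∫⁻ y : Fin 4 → F, S.indicator (fun D => (((NNReal.sqrt (normAbs F D))⁻¹ : ℝ≥0) : ℝ≥0∞))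
          ((!![y 1, y 2; y 0, y 3] : Matrix (Fin 2) (Fin 2) F)).charpoly.discr * g !![y 1, y 2; y 0, y 3] ∂(Measure.pi fun _ : Fin 4 => dx)
        = ∫⁻ y : Fin 4 → F, G (e0 y) ∂(Measure.pi fun _ : Fin 4 => dx) := by
          refine lintegral_congr fun y => ?_
          have h1 : (e0 y).1 = y 0 := rfl
          have h2' : (e0 y).2 = fun j : Fin 3 => y j.succ := by
            funext j; simp [e0, Fin.tail]
          rw [hGdef]
          simp only [h1, h2', Fin.succ_zero_eq_one, discr_charpoly_fin_two_explicit]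
          rfl
      _ = ∫⁻ p, G p ∂(dx.prod (Measure.pi fun _ : Fin 3 => dx)) := he0.lintegral_comp hG
      _ = ∫⁻ t, ∫⁻ x : Fin 3 → F, G (t, x) ∂(Measure.pi fun _ : Fin 3 => dx) ∂dx := lintegral_prod _ hG.aemeasurable
      _ = ∫⁻ x : Fin 3 → F, ∫⁻ t, G (t, x) ∂dx ∂(Measure.pi fun _ : Fin 3 => dx) := lintegral_lintegral_swap hG.aemeasurable
  -- assembly
  rw [hA, hB, lintegral_congr_ae hC', lintegral_const_mul _ hG.lintegral_prod_left', hD]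

end Pi

end Summit.HodgeConjecture.HodgeConjecture.Cruxes.H413.K2E3GL2BorelSliceLowerCell

end
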